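import Mathlib
import Literature.Combinatorics.Additive.TripleProductProperty
import Literature.Computability.AlgebraicComplexity.GroupTheoreticMatMulThmBProofs
import Literature.Computability.AlgebraicComplexity.STPPLineFamilies

/-!
# Translation counting in an abelian group of order `125` (lemmas for "no four `(4,4,4)` STPP triples")

Support file for route `MatrixMultiplication/GroupTheoreticSTPP`, crux `stmt-MatrixMultiplication-0597`,
cell `mm-stpp` (D-0046), CENSUS-PLAN §6 K-F3 (b); consumed by
`GroupTheoreticSTPPCThesisNoFour444Order125.lean` (memo `HOME/mm-stpp-eng-1/F3-PACKING-BOUND.md`, Theorem B).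

* counting helpers: `#{y : y − a ∈ S} = #S`, `∑_y #{q ∈ Q : y − q ∈ R} = #Q·#R`,
  `∑_t #{q ∈ Q : q − t ∈ Q} = #Q²`, and subadditivity of the translation defect
  `δ(t) = #{q ∈ Q : q − t ∉ Q}` (`defect_subadd`);
* two structural facts about an abelian group `H` with `|H| = 125`: a set of size prime to `5` is not
  invariant under a non-zero translation (`eq_zero_of_translate_subset`, via
  `Equiv.Perm.exists_fixed_point_of_prime`), and a non-empty set stable under adding a set of `≥ 26`
  elements is all of `H` (`eq_univ_of_add_subset`: the generated subgroup has order `> 25`, so it is `H`).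

WHAT THIS IS NOT: no STPP content yet (that is the companion file); elementary finite-group counting only.
-/

-- single-conjunct summit: the mandated namespace repeats `MatrixMultiplication`.
set_option linter.dupNamespace false

namespace Summit.MatrixMultiplication.MatrixMultiplication.Theorems

namespace STPPNoFour444

open Finset Literature.Combinatorics.Additive Literature.Computability.AlgebraicComplexity
open scoped Pointwise

variable {H : Type*} [AddCommGroup H] [Fintype H] [DecidableEq H]

/-! ### Counting helpers -/

/-- `#{y : y − a ∈ S} = #S` (translation is a bijection). [folklore] -/
theorem card_filter_sub_right_mem (S : Finset H) (a : H) :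
    (univ.filter fun y => y - a ∈ S).card = S.card := by
  refine (card_bij (fun y _ => y - a) (fun y hy => (mem_filter.1 hy).2) (fun y₁ _ y₂ _ h => ?_)
    (fun s hs => ⟨s + a, by simp [hs], by simp⟩))
  simpa using h

/-- `#{t : a − t ∈ S} = #S` (reflection is a bijection). [folklore] -/
theorem card_filter_sub_left_mem (S : Finset H) (a : H) :
    (univ.filter fun t => a - t ∈ S).card = S.card := by
  refine (card_bij (fun t _ => a - t) (fun t ht => (mem_filter.1 ht).2) (fun t₁ _ t₂ _ h => ?_)
    (fun s hs => ⟨a - s, by simp [hs], by simp⟩))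
  simpa using h

/-- `∑_y #{q ∈ Q : y − q ∈ R} = #Q · #R`. [folklore] -/
theorem sum_card_filter_sub_mem (Q R : Finset H) :
    ∑ y, (Q.filter fun q => y - q ∈ R).card = Q.card * R.card := by
  simp_rw [card_filter]
  rw [sum_comm]
  have : ∀ q ∈ Q, (∑ y, if y - q ∈ R then 1 else 0) = R.card := by
    intro q _
    rw [← card_filter_sub_right_mem R q, card_filter]
  rw [sum_congr rfl this, sum_const, smul_eq_mul]

/-- `∑_t #{q ∈ Q : q − t ∈ Q} = #Q²` (count ordered pairs of `Q` by their difference). [folklore] -/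
theorem sum_card_filter_self (Q : Finset H) :
    ∑ t, (Q.filter fun q => q - t ∈ Q).card = Q.card * Q.card := by
  simp_rw [card_filter]
  rw [sum_comm]
  have : ∀ q ∈ Q, (∑ t, if q - t ∈ Q then 1 else 0) = Q.card := by
    intro q _
    rw [← card_filter_sub_left_mem Q q, card_filter]
  rw [sum_congr rfl this, sum_const, smul_eq_mul]

omit [Fintype H] in
/-- Subadditivity of the translation defect `δ(t) = #{q ∈ Q : q − t ∉ Q} = |Q ∖ (Q + t)|`:
`δ(s + t) ≤ δ(s) + δ(t)`. [folklore] -/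
theorem defect_subadd (Q : Finset H) (s t : H) :
    (Q.filter fun q => q - (s + t) ∉ Q).card ≤
      (Q.filter fun q => q - s ∉ Q).card + (Q.filter fun q => q - t ∉ Q).card := by
  -- split according to whether `q - t ∈ Q`
  have hsplit := (card_filter_add_card_filter_not (s := Q.filter fun q => q - (s + t) ∉ Q)
    (fun q => q - t ∈ Q))
  rw [← hsplit]
  refine Nat.add_le_add ?_ ?_
  · -- `q - t ∈ Q` but `(q - t) - s ∉ Q`: inject by `q ↦ q - t` into the `s`-defect set
    refine card_le_card_of_injOn (fun q => q - t) ?_ ?_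
    · intro q hq
      simp only [coe_filter, Set.mem_setOf_eq, mem_filter] at hq ⊢
      refine ⟨hq.2, ?_⟩
      have : q - t - s = q - (s + t) := by abel
      rw [this]; exact hq.1.2
    · intro q₁ _ q₂ _ h
      exact sub_left_injective h
  · -- `q - t ∉ Q`: a subset of the `t`-defect set
    refine card_le_card ?_
    intro q hq
    simp only [mem_filter] at hq ⊢
    exact ⟨hq.1.1, hq.2⟩

/-! ### Two structural facts about a group of order `125` -/

omit [DecidableEq H] in
/-- In an abelian group of order `125`, a set of size not divisible by `5` is not invariant under a
non-zero translation. [folklore] -/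
theorem eq_zero_of_translate_subset (hH : Fintype.card H = 125) (Q : Finset H) (h5 : ¬ 5 ∣ Q.card)
    (t : H) (ht : ∀ q ∈ Q, q + t ∈ Q) : t = 0 := by
  haveI : Fact (Nat.Prime 5) := ⟨by norm_num⟩
  -- translation by `t` as a permutation of `↥Q`
  let f : Q → Q := fun q => ⟨q.1 + t, ht q.1 q.2⟩
  have hf : Function.Injective f := by
    intro q₁ q₂ h
    have : (q₁ : H) + t = q₂ + t := congrArg Subtype.val h
    exact Subtype.ext (add_right_cancel this)
  let σ : Equiv.Perm Q := Equiv.ofBijective f hf.bijective_of_finite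
  have hσn : ∀ n : ℕ, ∀ q : Q, ((σ ^ n) q : H) = (q : H) + n • t := by
    intro n
    induction n with
    | zero => intro q; simp
    | succ n ih =>
        intro q
        rw [pow_succ', Equiv.Perm.mul_apply]
        show ((σ ^ n) q : H) + t = _
        rw [ih, succ_nsmul, add_assoc]
  have hσ : σ ^ 5 ^ 3 = 1 := by
    ext q
    have h125 : (5 ^ 3 : ℕ) • t = 0 := by
      have := card_nsmul_eq_zero (x := t)   -- `Fintype.card H • t = 0`
      rw [hH] at this
      exact this
    have := hσn (5 ^ 3) q
    rw [h125, add_zero] at this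
    exact this
  have hcard : ¬ 5 ∣ Fintype.card Q := by rwa [Fintype.card_coe]
  obtain ⟨q, hq⟩ := Equiv.Perm.exists_fixed_point_of_prime hcard hσ
  have : (q : H) + t = q := by
    have := congrArg Subtype.val hq
    simpa [σ, f] using this
  simpa using this

/-- In an abelian group of order `125`, a non-empty set stable under adding a set `D` of at least `26`
elements is everything (the subgroup generated by `D` has order `> 25`, hence is the whole group).
[folklore] -/
theorem eq_univ_of_add_subset (hH : Fintype.card H = 125) (D X : Finset H) (hD : 26 ≤ D.card)
    (hX : X.Nonempty) (h : X + D ⊆ X) : X = univ := by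
  classical
  -- every `d ∈ D` translates `X` onto itself
  have hstab : ∀ d ∈ D, ∀ x ∈ X, x + d ∈ X ∧ x - d ∈ X := by
    intro d hd
    have hsub : ∀ x ∈ X, x + d ∈ X := fun x hx => h (add_mem_add hx hd)
    have himg : X.image (· + d) = X := by
      apply eq_of_subset_of_card_le
      · intro y hy
        obtain ⟨x, hx, rfl⟩ := mem_image.1 hy
        exact hsub x hx
      · rw [card_image_of_injective _ (add_left_injective d)]
    intro x hx
    refine ⟨hsub x hx, ?_⟩
    rw [← himg] at hx
    obtain ⟨x', hx', hx'x⟩ := mem_image.1 hx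
    have : x - d = x' := by rw [← hx'x]; simp
    rw [this]; exact hx'
  -- hence every element of the subgroup generated by `D` does
  set K := AddSubgroup.closure (D : Set H) with hK
  have hK_stab : ∀ k ∈ K, ∀ x ∈ X, x + k ∈ X ∧ x - k ∈ X := by
    intro k hk
    refine AddSubgroup.closure_induction (p := fun k _ => ∀ x ∈ X, x + k ∈ X ∧ x - k ∈ X)
      ?_ ?_ ?_ ?_ hk
    · intro d hd; exact hstab d hd
    · intro x hx; simp [hx]
    · intro a b _ _ ha hb x hx
      refine ⟨?_, ?_⟩
      · have := (hb (x + a) (ha x hx).1).1; rwa [add_assoc] at this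
      · have := (hb (x - a) (ha x hx).2).2; rwa [sub_sub] at this
    · intro a _ ha x hx
      refine ⟨?_, ?_⟩
      · simpa [sub_eq_add_neg] using (ha x hx).2
      · simpa [sub_eq_add_neg] using (ha x hx).1
  -- `K` has more than `25` elements and its order divides `125 = 5³`, so `K = ⊤`
  have hK_top : K = ⊤ := by
    have hdvd : Nat.card K ∣ 5 ^ 3 := by
      have := AddSubgroup.card_addSubgroup_dvd_card K
      rwa [Nat.card_eq_fintype_card (α := H), hH] at this
    have hge : 26 ≤ Nat.card K := by
      have hinj : Function.Injective (fun d : D => (⟨d.1, AddSubgroup.subset_closure d.2⟩ : K)) := by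
        intro d₁ d₂ hd
        exact Subtype.ext (by simpa using congrArg Subtype.val hd)
      have := Nat.card_le_card_of_injective _ hinj
      rw [Nat.card_eq_finsetCard] at this
      omega
    obtain ⟨m, hm, hmK⟩ := (Nat.dvd_prime_pow (by norm_num : Nat.Prime 5)).1 hdvd
    have hm3 : m = 3 := by
      interval_cases m <;> simp_all
    rw [hm3] at hmK
    apply AddSubgroup.eq_top_of_card_eq
    rw [hmK, Nat.card_eq_fintype_card, hH]; norm_num
  -- conclude
  obtain ⟨x₀, hx₀⟩ := hX
  apply eq_univ_of_forall
  intro y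
  have hy : y - x₀ ∈ K := by rw [hK_top]; exact AddSubgroup.mem_top _
  have := (hK_stab (y - x₀) hy x₀ hx₀).1
  rwa [add_sub_cancel] at this

end STPPNoFour444

end Summit.MatrixMultiplication.MatrixMultiplication.Theorems
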